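import Literature.NumberTheory.Transcendental.RoySmallValueEstimatesTheoremOneProofs
import Literature.NumberTheory.Transcendental.RoySmallValueEstimatesHomogenizationProofs
import HarnessLib

/-!
# Small value estimates at rational translates (Nguyen–Roy 2016) — proofs: Theorem 1 in full (the reduction `|s| < 1 → |s| > 1` by reversing the order of the translates)

Final proofs file for `Literature.NumberTheory.Transcendental.nguyenRoy2016_thm_1` (Nguyen–Roy,
*A small value estimate in dimension two involving translations by rational points*, IJNT 12 (2016)
1273–1293 = arXiv:1412.5163, Theorem 1). Everything here is PROVED; four auxiliary definitions
with bodies (`shiftCoeff`, `shiftMon`, `shiftPoly`, `ratMax`), no named facts. It discharges the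
fact: **`nguyenRoy2016_thm_1_holds : nguyenRoy2016_thm_1`**.

The tree already proves Theorem 1 for `|s| > 1` and every `1 ≤ σ < 2`
(`NguyenRoy.thm1_of_one_lt_abs_s`, file `RoySmallValueEstimatesTheoremOneProofs`, following
§§3–6 of the paper). The paper reduces `|s| < 1` to `|s| > 1` in **Lemma 3** (§2, p. 5 of the
arXiv text) through `P̃_D = X₂^{⌊D/2⌋} P_{⌊D/2⌋}(X₁, X₂⁻¹)`; as recorded in
`RoySmallValueEstimatesReductionProofs`, that polynomial is known to be small at
`4⌊⌊D/2⌋^σ⌋ < 4⌊D^σ⌋` translates only, a loss which the openness of condition (1) absorbs for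
`σ > 1` but not at `σ = 1`.

Here the reduction is carried out WITHOUT loss, for every `σ`, by reading the translates in the
reverse order. With `N = 4⌊D^σ⌋` and `k = N − 1`, the points of the hypothesis are
`γ_{k−j} = (ξ + (k−j)r, η s^{k−j}) = ((ξ + kr) − jr, (η s^k)(s⁻¹)^j)` (`0 ≤ j < N`): the same
pattern of translates, by the rational point `(−r, s⁻¹)` with `|s⁻¹| > 1`, but based at the
`D`-dependent point `(ξ + kr, η s^k) = Φ^k`-image of `(ξ, η)` (`Φ` the translation automorphism
of §2). Moving the base point back with the substitution
`P̂_D(X₁, X₂) = q^D v^{kD} P_D(X₁ + kr, s^k X₂) ∈ ℤ[X₁, X₂]` (`r = p/q`, `s = u/v`; this is the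
dehomogenisation of `m^{kD} Φ^k` of Proposition 4) costs a factor `e^{O(D^{1+σ})}` on the norm and
on the values (`shiftPoly`, `aeval_shiftPoly`, `mvPolyHeight_shiftPoly_le`), which is absorbed by
enlarging `β` and lowering `ν` slightly (`smallValue_hyp_rev`), since `β, ν > 1 + σ` and condition
(1) is open in `(β, ν)` at fixed `σ` (`exists_larger_params`: the correction term
`(σ−1)(3−2σ)/(2+β−2σ)` decreases in `β`). Hence Theorem 1 for `|s| > 1` implies Theorem 1 for
every `s ∈ ℚ ∖ {0, ±1}` and every `1 ≤ σ < 2` (`thm1_of_one_lt_abs_all`, the repaired Lemma 3),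
and `nguyenRoy2016_thm_1_holds` follows from `NguyenRoy.thm1_of_one_lt_abs_s`.

* `shiftPoly D k r s P` — the integer polynomial `q^D v^{kD} P(X₁ + kr, s^k X₂)`;
  `aeval_shiftPoly`, `totalDegree_shiftPoly_le`, `shiftPoly_ne_zero`, `mvPolyHeight_shiftPoly_le`;
* `smallValue_hyp_rev` — the hypothesis of Theorem 1 passes from `(ξ, η, r, s; σ, β, ν)` to
  `(ξ, η, −r, s⁻¹; σ, β', ν')` for any `β' > β`, `ν' < ν` with `1 + σ < β'`, `1 + σ < ν`;
* `exists_larger_params` — openness of condition (1) in `(β, ν)`;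
* `thm1_of_one_lt_abs_all` — Lemma 3 for all `1 ≤ σ < 2`;
* `nguyenRoy2016_thm_1_holds`.

## References

* [NguyenRoy2016] N. A. V. Nguyen, D. Roy, IJNT 12 (2016) 1273–1293 = arXiv:1412.5163: Theorem 1
  and condition (1) (p. 2), §2 Lemma 3 and the automorphism `Φ` (p. 5), Proposition 4, §6.
-/

noncomputable section

open MvPolynomial Filter Finset
open Literature.NumberTheory.Transcendental.Nesterenko (l1Norm maxNorm l1Norm_mul_le l1Norm_C
  l1Norm_X l1Norm_pow_le maxNorm_le_l1Norm l1Norm_nonneg l1Norm_add_le l1Norm_sum_le)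

namespace Literature.NumberTheory.Transcendental

namespace NguyenRoy

/-! ### The polynomial `q^D v^{kD} P(X₁ + kr, s^k X₂)` -/

/-- The integer scalar `c_e = a_e q^{D−e₀} u^{k e₁} v^{k(D−e₁)}` attached to the monomial
`a_e X₁^{e₀} X₂^{e₁}` of `P` (`r = p/q`, `s = u/v` in lowest terms). [cite: NguyenRoy2016, §2 (Φ) and Proposition 4 (integrality of m^{iD}Φ^i)] -/
def shiftCoeff (D k : ℕ) (r s : ℚ) (P : MvPolynomial (Fin 2) ℤ) (e : Fin 2 →₀ ℕ) : ℤ :=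
  coeff e P * (r.den : ℤ) ^ (D - e 0) * (s.num ^ (k * e 1) * (s.den : ℤ) ^ (k * (D - e 1)))

/-- The integer polynomial `(qX₁ + kp)^{e₀} X₂^{e₁}`. [cite: NguyenRoy2016, §2 (Φ)] -/
def shiftMon (k : ℕ) (r : ℚ) (e : Fin 2 →₀ ℕ) : MvPolynomial (Fin 2) ℤ :=
  (C (r.den : ℤ) * X 0 + C ((k : ℤ) * r.num)) ^ (e 0) * X 1 ^ (e 1)

/-- **`P̂ = q^D v^{kD} P(X₁ + kr, s^k X₂) ∈ ℤ[X₁, X₂]`** for `P` of degree `≤ D`, written out as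
`∑_e c_e (qX₁ + kp)^{e₀} X₂^{e₁}`: the dehomogenisation of `m^{kD}Φ^k` applied to `P`.
[cite: NguyenRoy2016, §2 (the automorphism Φ, Lemma 3) and Proposition 4] -/
def shiftPoly (D k : ℕ) (r s : ℚ) (P : MvPolynomial (Fin 2) ℤ) : MvPolynomial (Fin 2) ℤ :=
  ∑ e ∈ P.support, C (shiftCoeff D k r s P e) * shiftMon k r e

/-- `deg ((qX₁ + kp)^{e₀} X₂^{e₁}) ≤ e₀ + e₁`. [folklore] -/
theorem totalDegree_shiftMon_le (k : ℕ) (r : ℚ) (e : Fin 2 →₀ ℕ) :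
    (shiftMon k r e).totalDegree ≤ e 0 + e 1 := by
  unfold shiftMon
  refine (totalDegree_mul _ _).trans (add_le_add ?_ ?_)
  · refine (totalDegree_pow _ _).trans ?_
    have h1 : (C (r.den : ℤ) * X (0 : Fin 2) + C ((k : ℤ) * r.num)).totalDegree ≤ 1 := by
      refine (totalDegree_add _ _).trans (max_le ?_ ?_)
      · refine (totalDegree_mul _ _).trans ?_
        rw [totalDegree_C, totalDegree_X, zero_add]
      · rw [totalDegree_C]; exact zero_le_one
    calc e 0 * (C (r.den : ℤ) * X (0 : Fin 2) + C ((k : ℤ) * r.num)).totalDegree ≤ e 0 * 1 :=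
          Nat.mul_le_mul_left _ h1
      _ = e 0 := mul_one _
  · rw [totalDegree_X_pow]

/-- **`deg P̂ ≤ D`** for `deg P ≤ D`. [cite: NguyenRoy2016, Lemma 3 ("has degree at most D")] -/
theorem totalDegree_shiftPoly_le {D : ℕ} (k : ℕ) (r s : ℚ) {P : MvPolynomial (Fin 2) ℤ}
    (hP : P.totalDegree ≤ D) : (shiftPoly D k r s P).totalDegree ≤ D := by
  unfold shiftPoly
  refine (totalDegree_finsetSum _ _).trans (Finset.sup_le fun e he => ?_)
  refine (totalDegree_mul _ _).trans ?_
  rw [totalDegree_C, zero_add]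
  exact (totalDegree_shiftMon_le k r e).trans (apply_one_le_of_mem_support hP he)

/-- The value of one term: `c_e (qx + kp)^{e₀} y^{e₁} = q^D v^{kD} a_e (x + kr)^{e₀} (s^k y)^{e₁}`
for `e₀, e₁ ≤ D`. [folklore] -/
theorem aeval_C_shiftCoeff_mul_shiftMon {D k : ℕ} (r s : ℚ) (P : MvPolynomial (Fin 2) ℤ)
    {e : Fin 2 →₀ ℕ} (h0 : e 0 ≤ D) (h1 : e 1 ≤ D) (x y : ℂ) :
    aeval ![x, y] (C (shiftCoeff D k r s P e) * shiftMon k r e) =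
      (r.den : ℂ) ^ D * (s.den : ℂ) ^ (k * D) *
        (((coeff e P : ℤ) : ℂ) * (x + k * (r : ℂ)) ^ (e 0) * ((s : ℂ) ^ k * y) ^ (e 1)) := by
  obtain ⟨a, ha⟩ := Nat.exists_eq_add_of_le h0
  obtain ⟨b, hb⟩ := Nat.exists_eq_add_of_le h1
  have hr' : (r : ℂ) * (r.den : ℂ) = (r.num : ℂ) := by
    rw [← Rat.cast_natCast, ← Rat.cast_mul, Rat.mul_den_eq_num, Rat.cast_intCast]
  have hs' : (s : ℂ) * (s.den : ℂ) = (s.num : ℂ) := by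
    rw [← Rat.cast_natCast, ← Rat.cast_mul, Rat.mul_den_eq_num, Rat.cast_intCast]
  have hDa : D - e 0 = a := by omega
  have hDb : D - e 1 = b := by omega
  have hkD : k * (e 0 + a) = k * e 1 + k * b := by rw [← hb.symm.trans ha]; ring
  have hlin : (r.den : ℂ) * x + (k : ℂ) * (r.num : ℂ) = (r.den : ℂ) * (x + (k : ℂ) * (r : ℂ)) := by
    linear_combination -(k : ℂ) * hr'
  have hpow : (s.num : ℂ) ^ k = (s : ℂ) ^ k * (s.den : ℂ) ^ k := by rw [← mul_pow, hs']
  simp only [shiftCoeff, shiftMon, map_mul, map_pow, map_add, aeval_C, aeval_X,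
    Matrix.cons_val_zero, Matrix.cons_val_one, hDa, hDb]
  simp only [algebraMap_int_eq, eq_intCast, Int.cast_natCast]
  rw [hlin, ha, hkD]
  simp only [pow_add, pow_mul, mul_pow, hpow]
  ring

/-- **`P̂(x, y) = q^D v^{kD} P(x + kr, s^k y)`**. [cite: NguyenRoy2016, §2 (Φ) and Lemma 3] -/
theorem aeval_shiftPoly {D : ℕ} (k : ℕ) (r s : ℚ) {P : MvPolynomial (Fin 2) ℤ}
    (hP : P.totalDegree ≤ D) (x y : ℂ) :
    aeval ![x, y] (shiftPoly D k r s P) =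
      (r.den : ℂ) ^ D * (s.den : ℂ) ^ (k * D) * aeval ![x + k * (r : ℂ), (s : ℂ) ^ k * y] P := by
  unfold shiftPoly
  rw [map_sum]
  conv_rhs => rw [P.as_sum, map_sum, Finset.mul_sum]
  refine Finset.sum_congr rfl fun e he => ?_
  have h := apply_one_le_of_mem_support hP he
  rw [aeval_C_shiftCoeff_mul_shiftMon r s P (by omega) (by omega), aeval_monomial,
    Finsupp.prod_fintype _ _ (fun _ => by rw [pow_zero]), Fin.prod_univ_two]
  simp only [Matrix.cons_val_zero, Matrix.cons_val_one, algebraMap_int_eq, eq_intCast]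
  ring

/-- **`P̂ ≠ 0`** for `P ≠ 0` of degree `≤ D` and `s ≠ 0` (the substitution is invertible over
`ℂ`). [cite: NguyenRoy2016, Lemma 3] -/
theorem shiftPoly_ne_zero {D : ℕ} (k : ℕ) (r : ℚ) {s : ℚ} (hs : s ≠ 0)
    {P : MvPolynomial (Fin 2) ℤ} (hP : P.totalDegree ≤ D) (h0 : P ≠ 0) :
    shiftPoly D k r s P ≠ 0 := by
  intro h
  apply h0
  apply MvPolynomial.map_injective (Int.castRingHom ℂ) Int.cast_injective
  rw [map_zero]
  apply MvPolynomial.funext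
  intro z
  rw [map_zero, eval_map]
  have hsC : (s : ℂ) ≠ 0 := by exact_mod_cast hs
  have hq : (r.den : ℂ) ≠ 0 := Nat.cast_ne_zero.mpr r.den_nz
  have hv : (s.den : ℂ) ≠ 0 := Nat.cast_ne_zero.mpr s.den_nz
  set x : ℂ := z 0 - k * (r : ℂ) with hx
  set y : ℂ := ((s : ℂ) ^ k)⁻¹ * z 1 with hy
  have key := aeval_shiftPoly k r s hP x y
  rw [h, map_zero] at key
  have hc : (r.den : ℂ) ^ D * (s.den : ℂ) ^ (k * D) ≠ 0 :=
    mul_ne_zero (pow_ne_zero _ hq) (pow_ne_zero _ hv)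
  have hval : aeval ![x + k * (r : ℂ), (s : ℂ) ^ k * y] P = 0 := by
    rcases mul_eq_zero.mp key.symm with h1 | h1
    · exact absurd h1 hc
    · exact h1
  have hx' : x + k * (r : ℂ) = z 0 := by rw [hx]; ring
  have hy' : (s : ℂ) ^ k * y = z 1 := by
    rw [hy, ← mul_assoc, mul_inv_cancel₀ (pow_ne_zero _ hsC), one_mul]
  have hz : (![z 0, z 1] : Fin 2 → ℂ) = z := by
    funext i
    fin_cases i <;> rfl
  rw [hx', hy', hz, MvPolynomial.aeval_def, algebraMap_int_eq] at hval
  exact hval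

/-! ### The height of `P̂` -/

/-- `𝓛((qX₁ + c))` ≤ `q + |c|` over `ℂ`. [folklore] -/
theorem l1Norm_linear_le (q c : ℂ) :
    l1Norm (C q * X (0 : Fin 2) + C c : MvPolynomial (Fin 2) ℂ) ≤ ‖q‖ + ‖c‖ := by
  refine (l1Norm_add_le _ _).trans (add_le_add ?_ ?_)
  · refine (l1Norm_mul_le _ _).trans ?_
    rw [l1Norm_C, l1Norm_X, mul_one]
  · rw [l1Norm_C]

/-- The size of the scalars: `|c_e| ≤ H(P) q^{D−e₀} M^{kD}` with `M = max(|u|, v)`, for `e₁ ≤ D`.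
[folklore] -/
theorem norm_shiftCoeff_le {D k : ℕ} (r s : ℚ) (P : MvPolynomial (Fin 2) ℤ) {e : Fin 2 →₀ ℕ}
    (h1 : e 1 ≤ D) :
    ‖(shiftCoeff D k r s P e : ℂ)‖ ≤
      (mvPolyHeight P : ℝ) * (r.den : ℝ) ^ (D - e 0) *
        (max (|(s.num : ℝ)|) (s.den : ℝ)) ^ (k * D) := by
  set M : ℝ := max (|(s.num : ℝ)|) (s.den : ℝ) with hM
  have hM0 : 0 ≤ M := le_trans (abs_nonneg _) (le_max_left _ _)
  have hcoef : ‖((coeff e P : ℤ) : ℂ)‖ ≤ (mvPolyHeight P : ℝ) := by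
    rw [Complex.norm_intCast]
    have h := natAbs_coeff_le_mvPolyHeight P e
    have h' : (((coeff e P).natAbs : ℤ) : ℝ) ≤ ((mvPolyHeight P : ℕ) : ℝ) := by exact_mod_cast h
    rw [Int.natCast_natAbs, Int.cast_abs] at h'
    exact_mod_cast h'
  have hu : ‖((s.num : ℤ) : ℂ)‖ ≤ M := by
    rw [Complex.norm_intCast, hM]; exact le_max_left _ _
  have hv : ‖((s.den : ℕ) : ℂ)‖ ≤ M := by
    rw [Complex.norm_natCast, hM]; exact le_max_right _ _
  have hkD : k * e 1 + k * (D - e 1) = k * D := by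
    rw [← Nat.mul_add]; congr 1; omega
  unfold shiftCoeff
  push_cast
  rw [norm_mul, norm_mul, norm_mul, norm_pow, norm_pow, norm_pow, Complex.norm_natCast]
  calc ‖((coeff e P : ℤ) : ℂ)‖ * (r.den : ℝ) ^ (D - e 0) *
        (‖((s.num : ℤ) : ℂ)‖ ^ (k * e 1) * ‖((s.den : ℕ) : ℂ)‖ ^ (k * (D - e 1)))
      ≤ (mvPolyHeight P : ℝ) * (r.den : ℝ) ^ (D - e 0) * (M ^ (k * e 1) * M ^ (k * (D - e 1))) := by
        refine mul_le_mul (mul_le_mul_of_nonneg_right hcoef (by positivity)) ?_ (by positivity)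
          (by positivity)
        exact mul_le_mul (pow_le_pow_left₀ (norm_nonneg _) hu _)
          (pow_le_pow_left₀ (norm_nonneg _) hv _) (by positivity) (by positivity)
    _ = (mvPolyHeight P : ℝ) * (r.den : ℝ) ^ (D - e 0) * M ^ (k * D) := by
        rw [← pow_add, hkD]

/-- **The norm of `P̂`**: `‖P̂‖ ≤ (D+1)² ‖P‖ (q + k|p|)^D M^{kD}` (`M = max(|u|, v)`), via the
length `𝓛` over `ℂ`. [cite: NguyenRoy2016, Lemma 3 and Proposition 4 ("‖Φ^i P̃_D‖ ≤ e^{2D^β}")] -/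
theorem mvPolyHeight_shiftPoly_le {D : ℕ} (k : ℕ) (r s : ℚ) {P : MvPolynomial (Fin 2) ℤ}
    (hP : P.totalDegree ≤ D) :
    (mvPolyHeight (shiftPoly D k r s P) : ℝ) ≤
      ((D : ℝ) + 1) ^ 2 * (mvPolyHeight P : ℝ) * ((r.den : ℝ) + k * |(r.num : ℝ)|) ^ D *
        (max (|(s.num : ℝ)|) (s.den : ℝ)) ^ (k * D) := by
  classical
  set M : ℝ := max (|(s.num : ℝ)|) (s.den : ℝ) with hM
  set B : ℝ := (r.den : ℝ) + k * |(r.num : ℝ)| with hB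
  have hM0 : 0 ≤ M := le_trans (abs_nonneg _) (le_max_left _ _)
  have hq1 : (1 : ℝ) ≤ r.den := by exact_mod_cast r.den_pos
  have hqB : (r.den : ℝ) ≤ B := by rw [hB]; nlinarith [abs_nonneg (r.num : ℝ)]
  have hB0 : 0 ≤ B := le_trans (by positivity) hqB
  set Q : MvPolynomial (Fin 2) ℂ := map (Int.castRingHom ℂ) (shiftPoly D k r s P) with hQ
  -- `H(P̂) ≤ |Q| ≤ 𝓛(Q)`
  refine (mvPolyHeight_le_maxNorm_map _).trans ((maxNorm_le_l1Norm _).trans ?_)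
  -- `𝓛(Q) ≤ ∑_e |c_e| (q + k|p|)^{e₀}`
  have hQsum : map (Int.castRingHom ℂ) (shiftPoly D k r s P) =
      ∑ e ∈ P.support, C (shiftCoeff D k r s P e : ℂ) *
        ((C (r.den : ℂ) * X 0 + C ((k : ℂ) * (r.num : ℂ))) ^ (e 0) * X 1 ^ (e 1)) := by
    unfold shiftPoly shiftMon
    rw [map_sum]
    refine Finset.sum_congr rfl fun e _ => ?_
    simp only [map_mul, map_pow, map_add, map_C, map_X]
    simp only [eq_intCast, Int.cast_natCast]
  have hterm : ∀ e ∈ P.support,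
      l1Norm (C (shiftCoeff D k r s P e : ℂ) *
        ((C (r.den : ℂ) * X 0 + C ((k : ℂ) * (r.num : ℂ))) ^ (e 0) * X 1 ^ (e 1)) :
          MvPolynomial (Fin 2) ℂ) ≤ (mvPolyHeight P : ℝ) * B ^ D * M ^ (k * D) := by
    intro e he
    have hdeg := apply_one_le_of_mem_support hP he
    have h0 : e 0 ≤ D := by omega
    have h1 : e 1 ≤ D := by omega
    have hlin : l1Norm (C (r.den : ℂ) * X (0 : Fin 2) + C ((k : ℂ) * (r.num : ℂ)) :
        MvPolynomial (Fin 2) ℂ) ≤ B := by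
      refine (l1Norm_linear_le _ _).trans (le_of_eq ?_)
      rw [Complex.norm_natCast, norm_mul, Complex.norm_natCast, Complex.norm_intCast, hB]
    calc l1Norm (C (shiftCoeff D k r s P e : ℂ) *
          ((C (r.den : ℂ) * X 0 + C ((k : ℂ) * (r.num : ℂ))) ^ (e 0) * X 1 ^ (e 1)) :
            MvPolynomial (Fin 2) ℂ)
        ≤ l1Norm (C (shiftCoeff D k r s P e : ℂ) : MvPolynomial (Fin 2) ℂ) *
            l1Norm (((C (r.den : ℂ) * X 0 + C ((k : ℂ) * (r.num : ℂ))) ^ (e 0) * X 1 ^ (e 1)) :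
              MvPolynomial (Fin 2) ℂ) := l1Norm_mul_le _ _
      _ ≤ ‖(shiftCoeff D k r s P e : ℂ)‖ * (B ^ (e 0) * 1) := by
          rw [l1Norm_C]
          refine mul_le_mul_of_nonneg_left ?_ (norm_nonneg _)
          refine (l1Norm_mul_le _ _).trans (mul_le_mul ?_ ?_ (l1Norm_nonneg _) (by positivity))
          · exact (l1Norm_pow_le _ _).trans (pow_le_pow_left₀ (l1Norm_nonneg _) hlin _)
          · refine (l1Norm_pow_le _ _).trans ?_
            rw [l1Norm_X, one_pow]
      _ ≤ (mvPolyHeight P : ℝ) * (r.den : ℝ) ^ (D - e 0) * M ^ (k * D) * (B ^ (e 0) * 1) :=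
          mul_le_mul_of_nonneg_right (norm_shiftCoeff_le r s P h1) (by positivity)
      _ ≤ (mvPolyHeight P : ℝ) * B ^ (D - e 0) * M ^ (k * D) * (B ^ (e 0) * 1) := by
          gcongr
      _ = (mvPolyHeight P : ℝ) * B ^ D * M ^ (k * D) := by
          rw [mul_one, show B ^ D = B ^ (D - e 0) * B ^ (e 0) by rw [← pow_add, Nat.sub_add_cancel h0]]
          ring
  calc l1Norm Q = l1Norm (∑ e ∈ P.support, C (shiftCoeff D k r s P e : ℂ) *
        ((C (r.den : ℂ) * X 0 + C ((k : ℂ) * (r.num : ℂ))) ^ (e 0) * X 1 ^ (e 1)) :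
          MvPolynomial (Fin 2) ℂ) := by rw [hQ, hQsum]
    _ ≤ ∑ e ∈ P.support, l1Norm (C (shiftCoeff D k r s P e : ℂ) *
        ((C (r.den : ℂ) * X 0 + C ((k : ℂ) * (r.num : ℂ))) ^ (e 0) * X 1 ^ (e 1)) :
          MvPolynomial (Fin 2) ℂ) := l1Norm_sum_le _ _
    _ ≤ ∑ _e ∈ P.support, (mvPolyHeight P : ℝ) * B ^ D * M ^ (k * D) := Finset.sum_le_sum hterm
    _ = P.support.card * ((mvPolyHeight P : ℝ) * B ^ D * M ^ (k * D)) := by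
        rw [Finset.sum_const, nsmul_eq_mul]
    _ ≤ ((D : ℝ) + 1) ^ 2 * ((mvPolyHeight P : ℝ) * B ^ D * M ^ (k * D)) := by
        refine mul_le_mul_of_nonneg_right ?_ (by positivity)
        exact_mod_cast card_support_le_sq P hP
    _ = ((D : ℝ) + 1) ^ 2 * (mvPolyHeight P : ℝ) * B ^ D * M ^ (k * D) := by ring

/-- The common bound `m = max(q, |u|, v) ≥ 1` for `r = p/q`, `s = u/v`. [folklore] -/
def ratMax (r s : ℚ) : ℝ := max (r.den : ℝ) (max (|(s.num : ℝ)|) (s.den : ℝ))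

/-- `1 ≤ m`. [folklore] -/
theorem one_le_ratMax (r s : ℚ) : 1 ≤ ratMax r s :=
  le_trans (by exact_mod_cast r.den_pos) (le_max_left _ _)

/-- `0 ≤ m`. [folklore] -/
theorem ratMax_nonneg (r s : ℚ) : 0 ≤ ratMax r s := zero_le_one.trans (one_le_ratMax r s)

/-- **The norm of `P̂`, final form**: `‖P̂‖ ≤ (D+1)² ‖P‖ (1 + k|r|)^D m^{(k+1)D}`.
[cite: NguyenRoy2016, Lemma 3 and Proposition 4] -/
theorem mvPolyHeight_shiftPoly_le' {D : ℕ} (k : ℕ) (r s : ℚ) {P : MvPolynomial (Fin 2) ℤ}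
    (hP : P.totalDegree ≤ D) :
    (mvPolyHeight (shiftPoly D k r s P) : ℝ) ≤
      ((D : ℝ) + 1) ^ 2 * (mvPolyHeight P : ℝ) * (1 + k * |(r : ℝ)|) ^ D *
        ratMax r s ^ ((k + 1) * D) := by
  have hq0 : (0 : ℝ) < r.den := by exact_mod_cast r.den_pos
  have hrabs : |(r : ℝ)| = |(r.num : ℝ)| / (r.den : ℝ) := by
    rw [Rat.cast_def, abs_div, Nat.abs_cast]
  have hB : (r.den : ℝ) + k * |(r.num : ℝ)| = (r.den : ℝ) * (1 + k * |(r : ℝ)|) := by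
    rw [hrabs]; field_simp
  have hM : max (|(s.num : ℝ)|) (s.den : ℝ) ≤ ratMax r s := le_max_right _ _
  have hq : (r.den : ℝ) ≤ ratMax r s := le_max_left _ _
  have hM0 : 0 ≤ max (|(s.num : ℝ)|) (s.den : ℝ) := le_trans (abs_nonneg _) (le_max_left _ _)
  calc (mvPolyHeight (shiftPoly D k r s P) : ℝ)
      ≤ ((D : ℝ) + 1) ^ 2 * (mvPolyHeight P : ℝ) * ((r.den : ℝ) + k * |(r.num : ℝ)|) ^ D *
          (max (|(s.num : ℝ)|) (s.den : ℝ)) ^ (k * D) := mvPolyHeight_shiftPoly_le k r s hP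
    _ = ((D : ℝ) + 1) ^ 2 * (mvPolyHeight P : ℝ) * (1 + k * |(r : ℝ)|) ^ D *
          ((r.den : ℝ) ^ D * (max (|(s.num : ℝ)|) (s.den : ℝ)) ^ (k * D)) := by
        rw [hB, mul_pow]; ring
    _ ≤ ((D : ℝ) + 1) ^ 2 * (mvPolyHeight P : ℝ) * (1 + k * |(r : ℝ)|) ^ D *
          (ratMax r s ^ D * ratMax r s ^ (k * D)) := by
        refine mul_le_mul_of_nonneg_left ?_ (by positivity)
        exact mul_le_mul (pow_le_pow_left₀ hq0.le hq _) (pow_le_pow_left₀ hM0 hM _)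
          (by positivity) (pow_nonneg (ratMax_nonneg r s) _)
    _ = ((D : ℝ) + 1) ^ 2 * (mvPolyHeight P : ℝ) * (1 + k * |(r : ℝ)|) ^ D *
          ratMax r s ^ ((k + 1) * D) := by
        rw [← pow_add]; congr 2; ring

/-- The scalar of the values: `q^D v^{kD} ≤ m^{(k+1)D}`. [folklore] -/
theorem norm_scalar_le {D : ℕ} (k : ℕ) (r s : ℚ) :
    ‖(r.den : ℂ) ^ D * (s.den : ℂ) ^ (k * D)‖ ≤ ratMax r s ^ ((k + 1) * D) := by
  rw [norm_mul, norm_pow, norm_pow, Complex.norm_natCast, Complex.norm_natCast]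
  have hq : (r.den : ℝ) ≤ ratMax r s := le_max_left _ _
  have hv : (s.den : ℝ) ≤ ratMax r s := le_trans (le_max_right _ _) (le_max_right _ _)
  calc (r.den : ℝ) ^ D * (s.den : ℝ) ^ (k * D) ≤ ratMax r s ^ D * ratMax r s ^ (k * D) :=
        mul_le_mul (pow_le_pow_left₀ (Nat.cast_nonneg _) hq _)
          (pow_le_pow_left₀ (Nat.cast_nonneg _) hv _) (by positivity)
          (pow_nonneg (ratMax_nonneg r s) _)
    _ = ratMax r s ^ ((k + 1) * D) := by rw [← pow_add]; congr 1; ring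

/-! ### The transfer of the hypothesis by reversal of the translates -/

/-- **The hypothesis of Theorem 1 passes from `(ξ, η, r, s; σ, β, ν)` to
`(ξ, η, −r, s⁻¹; σ, β', ν')`** whenever `β < β'`, `ν' < ν`, `1 + σ < β'` and `1 + σ < ν`
(`σ ≥ 0`): with `N = 4⌊D^σ⌋`, `k = N − 1` and `P̂_D = q^D v^{kD} P_D(X₁ + kr, s^k X₂)` one has
`P̂_D ≠ 0`, `deg P̂_D ≤ D`, `‖P̂_D‖ ≤ (D+1)²(1 + k|r|)^D m^{(k+1)D} e^{D^β} ≤ e^{D^{β'}}` and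
`|P̂_D(ξ − jr, η s^{−j})| = q^D v^{kD} |P_D(ξ + (k−j)r, η s^{k−j})| ≤ m^{(k+1)D} e^{−D^ν} ≤ e^{−D^{ν'}}`
for `0 ≤ j < N` and `D` large. This replaces the polynomial `X₂^{⌊D/2⌋}P_{⌊D/2⌋}(X₁, X₂⁻¹)` of the
printed proof of Lemma 3 (which is small at `4⌊⌊D/2⌋^σ⌋` translates only) and loses no translate.
[cite: NguyenRoy2016, Lemma 3 (proof, repaired: the translates read in reverse order and the base point moved back by Φ^k as in Proposition 4)] -/
theorem smallValue_hyp_rev {ξ η : ℂ} {r s : ℚ} (hs0 : s ≠ 0)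
    {σ β ν β' ν' : ℝ} (hσ0 : 0 ≤ σ) (hβ' : 1 + σ < β') (hββ' : β < β') (hν1 : 1 + σ < ν)
    (hν' : ν' < ν)
    (H : ∀ᶠ D : ℕ in atTop, ∃ P : MvPolynomial (Fin 2) ℤ, P ≠ 0 ∧ P.totalDegree ≤ D ∧
      (mvPolyHeight P : ℝ) ≤ Real.exp ((D : ℝ) ^ β) ∧
      ∀ i : ℕ, i < 4 * ⌊(D : ℝ) ^ σ⌋₊ →
        ‖aeval ![ξ + (i : ℂ) * (r : ℂ), η * (s : ℂ) ^ i] P‖ ≤ Real.exp (-(D : ℝ) ^ ν)) :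
    ∀ᶠ D : ℕ in atTop, ∃ P : MvPolynomial (Fin 2) ℤ, P ≠ 0 ∧ P.totalDegree ≤ D ∧
      (mvPolyHeight P : ℝ) ≤ Real.exp ((D : ℝ) ^ β') ∧
      ∀ i : ℕ, i < 4 * ⌊(D : ℝ) ^ σ⌋₊ →
        ‖aeval ![ξ + (i : ℂ) * ((-r : ℚ) : ℂ), η * ((s⁻¹ : ℚ) : ℂ) ^ i] P‖ ≤
          Real.exp (-(D : ℝ) ^ ν') := by
  -- constants
  set m : ℝ := ratMax r s with hm
  have hm1 : 1 ≤ m := one_le_ratMax r s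
  have hm0 : 0 ≤ m := ratMax_nonneg r s
  set L : ℝ := Real.log m with hL
  have hL0 : 0 ≤ L := Real.log_nonneg hm1
  have hA0 : 0 ≤ |(r : ℝ)| := abs_nonneg _
  have hsC : (s : ℂ) ≠ 0 := by exact_mod_cast hs0
  -- thresholds
  have h3 : (0 : ℝ) < 1 / 3 := by norm_num
  have h2 : (0 : ℝ) < 1 / 2 := by norm_num
  have E1 : ∀ᶠ D : ℕ in atTop, 2 * (D : ℝ) ^ (1 : ℝ) ≤ 1 / 3 * (D : ℝ) ^ β' :=
    eventually_mul_rpow_le_mul_rpow _ (by linarith) h3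
  have E2 : ∀ᶠ D : ℕ in atTop, 1 * (D : ℝ) ^ β ≤ 1 / 3 * (D : ℝ) ^ β' :=
    eventually_mul_rpow_le_mul_rpow _ hββ' h3
  have h6 : (0 : ℝ) < 1 / 6 := by norm_num
  have E3 : ∀ᶠ D : ℕ in atTop, 4 * |(r : ℝ)| * (D : ℝ) ^ (1 + σ) ≤ 1 / 6 * (D : ℝ) ^ β' :=
    eventually_mul_rpow_le_mul_rpow _ hβ' h6
  have E3' : ∀ᶠ D : ℕ in atTop, 5 * L * (D : ℝ) ^ (1 + σ) ≤ 1 / 6 * (D : ℝ) ^ β' :=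
    eventually_mul_rpow_le_mul_rpow _ hβ' h6
  have E4 : ∀ᶠ D : ℕ in atTop, 5 * L * (D : ℝ) ^ (1 + σ) ≤ 1 / 2 * (D : ℝ) ^ ν :=
    eventually_mul_rpow_le_mul_rpow _ hν1 h2
  have E5 : ∀ᶠ D : ℕ in atTop, 1 * (D : ℝ) ^ ν' ≤ 1 / 2 * (D : ℝ) ^ ν :=
    eventually_mul_rpow_le_mul_rpow _ hν' h2
  filter_upwards [H, E1, E2, E3, E3', E4, E5, eventually_ge_atTop 1] with D hP hE1 hE2 hE3 hE3'
    hE4 hE5 hD1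
  obtain ⟨P, hP0, hPdeg, hPht, hPval⟩ := hP
  have hDpos : (0 : ℝ) < D := by exact_mod_cast hD1
  have hD1' : (1 : ℝ) ≤ D := by exact_mod_cast hD1
  -- the number of translates and the shift
  set N : ℕ := 4 * ⌊(D : ℝ) ^ σ⌋₊ with hN
  set k : ℕ := N - 1 with hk
  have hDσ1 : 1 ≤ (D : ℝ) ^ σ := Real.one_le_rpow hD1' hσ0
  have hNle : (N : ℝ) ≤ 4 * (D : ℝ) ^ σ := by
    rw [hN]; push_cast
    exact mul_le_mul_of_nonneg_left (Nat.floor_le (by positivity)) (by norm_num)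
  have hkle : (k : ℝ) ≤ 4 * (D : ℝ) ^ σ :=
    le_trans (by exact_mod_cast Nat.sub_le N 1) hNle
  have hk1le : (k : ℝ) + 1 ≤ 5 * (D : ℝ) ^ σ := by linarith
  have hD1σ : (D : ℝ) * (D : ℝ) ^ σ = (D : ℝ) ^ (1 + σ) := by
    rw [Real.rpow_add hDpos, Real.rpow_one]
  -- the scalar `m^{(k+1)D} ≤ exp(5 L D^{1+σ})`
  have hmpow : m ^ ((k + 1) * D) ≤ Real.exp (5 * L * (D : ℝ) ^ (1 + σ)) := by
    rw [← Real.rpow_natCast, Real.rpow_def_of_pos (by linarith), Real.exp_le_exp]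
    push_cast
    calc Real.log m * ((k + 1) * D) = L * (((k : ℝ) + 1) * D) := by rw [hL]
      _ ≤ L * (5 * (D : ℝ) ^ σ * D) :=
          mul_le_mul_of_nonneg_left (mul_le_mul_of_nonneg_right hk1le hDpos.le) hL0
      _ = 5 * L * (D : ℝ) ^ (1 + σ) := by rw [← hD1σ]; ring
  refine ⟨shiftPoly D k r s P, shiftPoly_ne_zero k r hs0 hPdeg hP0,
    totalDegree_shiftPoly_le k r s hPdeg, ?_, ?_⟩
  · -- height
    have hfac : (1 + k * |(r : ℝ)|) ^ D ≤ Real.exp (4 * |(r : ℝ)| * (D : ℝ) ^ (1 + σ)) := by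
      have h1 : 1 + k * |(r : ℝ)| ≤ Real.exp (k * |(r : ℝ)|) := by
        have := Real.add_one_le_exp (k * |(r : ℝ)|); linarith
      calc (1 + k * |(r : ℝ)|) ^ D ≤ Real.exp (k * |(r : ℝ)|) ^ D :=
            pow_le_pow_left₀ (by positivity) h1 D
        _ = Real.exp (D * (k * |(r : ℝ)|)) := by rw [← Real.exp_nat_mul]
        _ ≤ Real.exp (4 * |(r : ℝ)| * (D : ℝ) ^ (1 + σ)) := by
            rw [Real.exp_le_exp, ← hD1σ]
            calc (D : ℝ) * (k * |(r : ℝ)|) = (k : ℝ) * |(r : ℝ)| * D := by ring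
              _ ≤ 4 * (D : ℝ) ^ σ * |(r : ℝ)| * D := by gcongr
              _ = 4 * |(r : ℝ)| * ((D : ℝ) * (D : ℝ) ^ σ) := by ring
    have hD2 : ((D : ℝ) + 1) ^ 2 ≤ Real.exp (2 * D) := by
      have h := Real.add_one_le_exp (D : ℝ)
      calc ((D : ℝ) + 1) ^ 2 ≤ (Real.exp D) ^ 2 := pow_le_pow_left₀ (by positivity) h 2
        _ = Real.exp (2 * D) := by rw [← Real.exp_nat_mul]; norm_num
    calc (mvPolyHeight (shiftPoly D k r s P) : ℝ)
        ≤ ((D : ℝ) + 1) ^ 2 * (mvPolyHeight P : ℝ) * (1 + k * |(r : ℝ)|) ^ D * m ^ ((k + 1) * D) :=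
          mvPolyHeight_shiftPoly_le' k r s hPdeg
      _ ≤ Real.exp (2 * D) * Real.exp ((D : ℝ) ^ β) * Real.exp (4 * |(r : ℝ)| * (D : ℝ) ^ (1 + σ)) *
            Real.exp (5 * L * (D : ℝ) ^ (1 + σ)) := by
          refine mul_le_mul (mul_le_mul (mul_le_mul hD2 hPht (by positivity) (by positivity)) hfac
            (by positivity) (by positivity)) hmpow (pow_nonneg hm0 _) (by positivity)
      _ = Real.exp (2 * D + (D : ℝ) ^ β + 4 * |(r : ℝ)| * (D : ℝ) ^ (1 + σ) +
            5 * L * (D : ℝ) ^ (1 + σ)) := by simp only [← Real.exp_add]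
      _ ≤ Real.exp ((D : ℝ) ^ β') := by
          rw [Real.exp_le_exp]
          rw [Real.rpow_one] at hE1
          linarith [hE1, hE2, hE3, hE3']
  · -- values
    intro i hi
    have hik : i ≤ k := by omega
    obtain ⟨j, hj⟩ := Nat.exists_eq_add_of_le hik
    have hjN : j < N := by omega
    rw [aeval_shiftPoly k r s hPdeg, norm_mul]
    -- the point is `γ_j`
    have hx : ξ + (i : ℂ) * ((-r : ℚ) : ℂ) + (k : ℂ) * (r : ℂ) = ξ + (j : ℂ) * (r : ℂ) := by
      rw [hj]; push_cast; ring
    have hy : (s : ℂ) ^ k * (η * ((s⁻¹ : ℚ) : ℂ) ^ i) = η * (s : ℂ) ^ j := by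
      rw [hj]
      push_cast
      calc (s : ℂ) ^ (i + j) * (η * ((s : ℂ)⁻¹) ^ i)
          = η * (s : ℂ) ^ j * ((s : ℂ) ^ i * ((s : ℂ) ^ i)⁻¹) := by rw [pow_add, inv_pow]; ring
        _ = η * (s : ℂ) ^ j := by rw [mul_inv_cancel₀ (pow_ne_zero _ hsC), mul_one]
    rw [hx, hy]
    have hv := hPval j hjN
    calc ‖(r.den : ℂ) ^ D * (s.den : ℂ) ^ (k * D)‖ *
          ‖aeval ![ξ + (j : ℂ) * (r : ℂ), η * (s : ℂ) ^ j] P‖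
        ≤ m ^ ((k + 1) * D) * Real.exp (-(D : ℝ) ^ ν) :=
          mul_le_mul (norm_scalar_le k r s) hv (norm_nonneg _) (pow_nonneg hm0 _)
      _ ≤ Real.exp (5 * L * (D : ℝ) ^ (1 + σ)) * Real.exp (-(D : ℝ) ^ ν) :=
          mul_le_mul_of_nonneg_right hmpow (Real.exp_pos _).le
      _ = Real.exp (5 * L * (D : ℝ) ^ (1 + σ) - (D : ℝ) ^ ν) := by
          rw [← Real.exp_add, sub_eq_add_neg]
      _ ≤ Real.exp (-(D : ℝ) ^ ν') := by
          rw [Real.exp_le_exp]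
          linarith [hE4, hE5]

/-! ### Openness of condition (1) in `(β, ν)` -/

/-- **Condition (1) of Theorem 1 is open in `(β, ν)` at fixed `σ`**: if `1 ≤ σ < 2`, `σ + 1 < β`
and `ν` satisfies (1), there are `β' > β` and `ν' < ν` satisfying (1) (and `1 + σ < ν`). Explicit
choice: `δ = (ν − F(β))/3`, `β' = β + δ`, `ν' = ν − δ`, using that the correction term
`(σ−1)(3−2σ)/(2+β−2σ)` is non-increasing in `β`. [cite: NguyenRoy2016, Theorem 1 (condition (1)) and proof of Lemma 3 ("we choose ε > 0 sufficiently small so that the condition (1) still holds")] -/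
theorem exists_larger_params {σ β ν : ℝ} (h1 : 1 ≤ σ) (h2 : σ < 2) (hβ : σ + 1 < β)
    (hν1 : 3 / 2 ≤ σ → 2 + β - σ < ν)
    (hν2 : σ < 3 / 2 → 2 + β - σ + (σ - 1) * (3 - 2 * σ) / (2 + β - 2 * σ) < ν) :
    ∃ β' ν' : ℝ, β < β' ∧ ν' < ν ∧ 1 + σ < ν ∧
      (3 / 2 ≤ σ → 2 + β' - σ < ν') ∧
      (σ < 3 / 2 → 2 + β' - σ + (σ - 1) * (3 - 2 * σ) / (2 + β' - 2 * σ) < ν') := by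
  by_cases hσ : 3 / 2 ≤ σ
  · -- first regime: `F(β) = 2 + β − σ` is linear in `β`
    have hlt : 2 + β - σ < ν := hν1 hσ
    set δ : ℝ := (ν - (2 + β - σ)) / 3 with hδ
    have hδ0 : 0 < δ := by rw [hδ]; linarith
    refine ⟨β + δ, ν - δ, by linarith, by linarith, by linarith, fun _ => by linarith, ?_⟩
    intro h
    exact absurd hσ (not_le.mpr h)
  · -- second regime: the correction term is non-increasing in `β`
    push Not at hσ
    have hlt := hν2 hσ
    set c : ℝ := (σ - 1) * (3 - 2 * σ) with hc
    set d : ℝ := 2 + β - 2 * σ with hd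
    have hc0 : 0 ≤ c := mul_nonneg (by linarith) (by linarith)
    have hd0 : 0 < d := by rw [hd]; linarith
    have hcd0 : 0 ≤ c / d := div_nonneg hc0 hd0.le
    set δ : ℝ := (ν - (2 + β - σ + c / d)) / 3 with hδ
    have hδ0 : 0 < δ := by rw [hδ]; linarith
    refine ⟨β + δ, ν - δ, by linarith, by linarith, by linarith, ?_, ?_⟩
    · intro h
      exact absurd h (not_le.mpr hσ)
    · intro _
      have hmono : c / (2 + (β + δ) - 2 * σ) ≤ c / d := by
        rw [show 2 + (β + δ) - 2 * σ = d + δ by rw [hd]; ring]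
        exact div_le_div_of_nonneg_left hc0 hd0 (by linarith)
      linarith

/-! ### Lemma 3 for all `1 ≤ σ < 2`, and Theorem 1 -/

/-- **Nguyen–Roy 2016, Lemma 3** (repaired, all `1 ≤ σ < 2`). Suppose that the statement of
Theorem 1 holds whenever `|s| > 1`. Then it holds for every `s ∈ ℚ ∖ {0, ±1}`: for `|s| < 1`, apply
the case `|s⁻¹| > 1` to `(ξ, η, −r, s⁻¹)` with the parameters `(σ, β', ν')` of
`exists_larger_params` and the polynomials `P̂_D` of `smallValue_hyp_rev` (the translates read
in reverse order). [cite: NguyenRoy2016, Lemma 3] -/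
theorem thm1_of_one_lt_abs_all
    (H : ∀ (ξ η : ℂ), η ≠ 0 → ∀ (r s : ℚ), r ≠ 0 → 1 < |s| →
      ∀ (σ β ν : ℝ), 1 ≤ σ → σ < 2 → σ + 1 < β →
      (3 / 2 ≤ σ → 2 + β - σ < ν) →
      (σ < 3 / 2 → 2 + β - σ + (σ - 1) * (3 - 2 * σ) / (2 + β - 2 * σ) < ν) →
      (∀ᶠ D : ℕ in atTop, ∃ P : MvPolynomial (Fin 2) ℤ, P ≠ 0 ∧ P.totalDegree ≤ D ∧
        (mvPolyHeight P : ℝ) ≤ Real.exp ((D : ℝ) ^ β) ∧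
        ∀ i : ℕ, i < 4 * ⌊(D : ℝ) ^ σ⌋₊ →
          ‖aeval ![ξ + (i : ℂ) * (r : ℂ), η * (s : ℂ) ^ i] P‖ ≤ Real.exp (-(D : ℝ) ^ ν)) →
      IsAlgebraic ℚ ξ ∧ IsAlgebraic ℚ η)
    (ξ η : ℂ) (hη : η ≠ 0) (r s : ℚ) (hr : r ≠ 0) (hs0 : s ≠ 0) (hs1 : s ≠ 1) (hs2 : s ≠ -1)
    (σ β ν : ℝ) (h1 : 1 ≤ σ) (h2 : σ < 2) (hβ : σ + 1 < β)
    (hν1 : 3 / 2 ≤ σ → 2 + β - σ < ν)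
    (hν2 : σ < 3 / 2 → 2 + β - σ + (σ - 1) * (3 - 2 * σ) / (2 + β - 2 * σ) < ν)
    (hyp : ∀ᶠ D : ℕ in atTop, ∃ P : MvPolynomial (Fin 2) ℤ, P ≠ 0 ∧ P.totalDegree ≤ D ∧
      (mvPolyHeight P : ℝ) ≤ Real.exp ((D : ℝ) ^ β) ∧
      ∀ i : ℕ, i < 4 * ⌊(D : ℝ) ^ σ⌋₊ →
        ‖aeval ![ξ + (i : ℂ) * (r : ℂ), η * (s : ℂ) ^ i] P‖ ≤ Real.exp (-(D : ℝ) ^ ν)) :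
    IsAlgebraic ℚ ξ ∧ IsAlgebraic ℚ η := by
  have habs : |s| ≠ 1 := by
    intro h
    rcases (abs_eq zero_le_one).mp h with h' | h'
    · exact hs1 h'
    · exact hs2 h'
  rcases habs.lt_or_gt with hlt | hgt
  · -- `|s| < 1`: reverse the translates
    obtain ⟨β', ν', hββ', hν'ν, hσν, hc1, hc2⟩ := exists_larger_params h1 h2 hβ hν1 hν2
    have H' := smallValue_hyp_rev (ξ := ξ) (η := η) (r := r) hs0 (by linarith) (by linarith)
      hββ' hσν hν'ν hyp
    have hinv : 1 < |s⁻¹| := by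
      rw [abs_inv, one_lt_inv₀ (abs_pos.mpr hs0)]
      exact hlt
    exact H ξ η hη (-r) s⁻¹ (neg_ne_zero.mpr hr) hinv σ β' ν' h1 h2 (by linarith) hc1 hc2 H'
  · exact H ξ η hη r s hr hgt σ β ν h1 h2 hβ hν1 hν2 hyp

end NguyenRoy

/-- **Nguyen–Roy's small value estimate at rational translates holds** (Nguyen–Roy 2016,
Theorem 1, as vendored in `nguyenRoy2016_thm_1`): the case `|s| > 1` is
`NguyenRoy.thm1_of_one_lt_abs_s` (§§3–6 of the paper), and the case `|s| < 1` reduces to it by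
`NguyenRoy.thm1_of_one_lt_abs_all` (Lemma 3, with the translates read in reverse order).
[cite: NguyenRoy2016, Theorem 1, Lemma 3 and §6] -/
theorem nguyenRoy2016_thm_1_holds : nguyenRoy2016_thm_1 := by
  intro ξ η hη r s hr hs0 hs1 hs2 σ β ν hσ1 hσ2 hβ hν1 hν2 hP
  exact NguyenRoy.thm1_of_one_lt_abs_all
    (fun ξ η hη r s hr hs σ β ν hσ1 hσ2 hβ hν1 hν2 hP' =>
      NguyenRoy.thm1_of_one_lt_abs_s ξ η hη r s hr hs σ β ν hσ1 hσ2 hβ hν1 hν2 hP')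
    ξ η hη r s hr hs0 hs1 hs2 σ β ν hσ1 hσ2 hβ hν1 hν2 hP

end Literature.NumberTheory.Transcendental
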